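import Literature.AnabelianGeometry.SemiGraphs.SemiGraph
import Literature.AnabelianGeometry.Anabelioids.Basic

/-!
# Semi-graphs of anabelioids and the anabelioid `B(𝒢)` ([SemiAnbd] §2, Definition 2.1, pp. 22–24)

Mochizuki, *Semi-graphs of anabelioids*, Publ. RIMS **42** (2006) 221–322, §2 "Commensurability
Properties", author's manuscript pp. 22–24 [cite: MochizukiSemiAnbd2006, Def. 2.1 pp.22-24]:

* Definition 2.1: a *semi-graph of (connected) anabelioids* `𝒢` = (a) a semi-graph `𝔾`, (b) a
  connected anabelioid `𝒢_v` for each vertex, (c) a connected anabelioid `𝒢_e` for each edge with,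
  for each branch `b ∈ e` abutting to `v`, a morphism of anabelioids `b_* : 𝒢_e → 𝒢_v`; the
  *constituent anabelioids*; *of injective type* (all `b_*` are `π₁`-monomorphisms); *graph of
  anabelioids* (underlying semi-graph a graph); morphisms (spelled out in Remark 2.4.2, p. 26);
* the category `B(𝒢)` of systems `{S_v, φ_e}` (pp. 22–23) and the claim "one verifies immediately
  that this category `B(𝒢)` is a connected anabelioid" (NAMED FACT `bOf_galoisCategory`);
* `Π_𝒢 := π̂₁(B(𝒢))`, the fundamental groups `Π_v`, `Π_b` and the natural (outer) homomorphisms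
  `Π_v → Π_𝒢`, `Π_b → Π_v`, `Π_b → Π_𝒢` (p. 23); the restriction `𝒢_ℍ` to a sub-semi-graph and
  `Π_ℍ → Π_𝒢` (p. 24);
* Definition 2.2 (ii): locally trivial / locally finite étale / locally open morphisms.

## Rendering choices (recorded for the referee)

1. Constituent anabelioids are categories carrying Mathlib's `GaloisCategory` (= connected
   anabelioid, see `Anabelioids/Basic.lean`); `b_* : 𝒢_e → 𝒢_v` is an `Anabelioids.Hom`, i.e. an
   exact functor `b^* : 𝒢_v ⥤ 𝒢_e`.
2. Objects of `B(𝒢)`.  The paper's datum is `{S_v, φ_e}`: objects `S_v ∈ 𝒢_v` and, for each edge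
   `e` with branches `b₁, b₂` abutting to `v₁, v₂`, a gluing isomorphism
   `φ_e : b₁^* S_{v₁} ⥲ b₂^* S_{v₂}` in `𝒢_e`; when `𝔾` has no vertex (one isolated edge `e`) it sets
   `B(𝒢) := 𝒢_e`.  We use the equivalent "descent datum" form that needs no case distinction and
   no ordering of the two branches: objects `S_v ∈ 𝒢_v`, `T_e ∈ 𝒢_e` and, for every branch `b ∈ e`
   abutting to `v`, an isomorphism `ψ_b : b^* S_v ⥲ T_e` (so `φ_e = ψ_{b₁} ∘ ψ_{b₂}⁻¹`).  For
   connected `𝔾` with a vertex every edge has an abutting branch, so `T_e` is determined up to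
   unique isomorphism and the two categories are equivalent; for the vertexless case the
   category is literally `𝒢_e`.
3. Basepoints.  `Π_𝒢` "relative to some basepoint" is `Aut` of a fibre functor of `B(𝒢)`; we use
   the basepoints *through a vertex* `v`: `ρ_v ⋙ β` with `ρ_v : B(𝒢) ⥤ 𝒢_v`, `S ↦ S_v` and `β` a
   basepoint of `𝒢_v` (that these are fibre functors is part of `bOf_galoisCategory`).  The outer
   homomorphism `Π_v → Π_𝒢` is then the honest homomorphism `Anabelioids.pi1Map ρ_v β`, and
   similarly for branches and sub-semi-graphs; "well-defined up to conjugation" becomes "for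
   any choice of the transporting isomorphism of basepoints" in later statements.

Deliberately NOT here: finite étale coverings `𝒢' → 𝒢` (Def. 2.2 (i), needs the decomposition of
objects into connected components — `FiniteEtaleCoverings.lean`), Definitions 2.3–2.11 and
Proposition 2.5 ff. (`Commensurability.lean`), Remark 2.2.1 (pro-semi-graphs).
-/

namespace Literature.AnabelianGeometry.SemiGraphs

open CategoryTheory CategoryTheory.Limits CategoryTheory.PreGaloisCategory
open Literature.AnabelianGeometry.Anabelioids

universe w v₁ u₁ u

-- justification: as for Mathlib's `Cat.{v, u}`, the object/morphism universes of the constituent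
-- categories occur only together in the structure's type; they must stay independent (`B(G)`).
set_option linter.checkUnivs false in
/-- A *semi-graph of (connected) anabelioids* `𝒢` ([SemiAnbd] Definition 2.1, p. 22): (a) a
semi-graph `𝔾`; (b) for each vertex `v` a connected anabelioid `𝒢_v`; (c) for each edge `e` a
connected anabelioid `𝒢_e` together with, for each branch `b ∈ e` abutting to a vertex `v`, a
morphism of anabelioids `b_* : 𝒢_e → 𝒢_v` (an exact functor `b^* : 𝒢_v ⥤ 𝒢_e`).
[cite: MochizukiSemiAnbd2006, Def. 2.1 p.22] -/
structure SemiGraphOfAnabelioids where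
  /-- (a) the underlying semi-graph `𝔾` -/
  graph : SemiGraph.{u}
  /-- (b) the constituent anabelioid `𝒢_v` at a vertex, as a category … -/
  V : graph.Vertex → Type u₁
  /-- … with its category structure … -/
  [catV : ∀ v, Category.{v₁} (V v)]
  /-- … which is a connected anabelioid (Galois category) -/
  [galV : ∀ v, GaloisCategory (V v)]
  /-- (c) the constituent anabelioid `𝒢_e` at an edge, as a category … -/
  E : graph.Edge → Type u₁
  /-- … with its category structure … -/
  [catE : ∀ e, Category.{v₁} (E e)]
  /-- … which is a connected anabelioid (Galois category) -/
  [galE : ∀ e, GaloisCategory (E e)]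
  /-- (c) `b_* : 𝒢_e → 𝒢_v` for each branch `b` of `e` abutting to `v` -/
  pull : ∀ (b : graph.Branch) (v : graph.Vertex), graph.abuts b = some v →
    Anabelioids.Hom (E (graph.edgeOf b)) (V v)

attribute [instance] SemiGraphOfAnabelioids.catV SemiGraphOfAnabelioids.galV
  SemiGraphOfAnabelioids.catE SemiGraphOfAnabelioids.galE

namespace SemiGraphOfAnabelioids

variable (𝒢 : SemiGraphOfAnabelioids.{v₁, u₁, u})

/-- `𝒢` is *of injective type* if all the `b_*` are `π₁`-monomorphisms ([SemiAnbd] Def. 2.1 p. 22).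
[cite: MochizukiSemiAnbd2006, Def. 2.1 p.22] -/
@[mk_iff] structure IsOfInjectiveType : Prop where
  /-- every `b_*` induces an injection on fundamental groups -/
  isPi1Mono : ∀ (b : 𝒢.graph.Branch) (v : 𝒢.graph.Vertex) (h : 𝒢.graph.abuts b = some v),
    IsPi1Mono (𝒢.pull b v h).pullback

/-- `𝒢` is a *graph of (connected) anabelioids* if its underlying semi-graph is a graph
([SemiAnbd] Def. 2.1 p. 22). [cite: MochizukiSemiAnbd2006, Def. 2.1 p.22] -/
@[mk_iff] structure IsGraphOfAnabelioids : Prop where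
  /-- the underlying semi-graph is a graph -/
  isGraph : 𝒢.graph.IsGraph

/-- `𝒢` is *connected* if its underlying semi-graph is connected ([SemiAnbd] p. 22).
[cite: MochizukiSemiAnbd2006, Def. 2.1 p.22] -/
@[mk_iff] structure IsConnected : Prop where
  /-- the underlying semi-graph is connected -/
  isConnected : 𝒢.graph.IsConnected

/-! ### The anabelioid `B(𝒢)` (pp. 22–23) -/

/-- An object of `B(𝒢)` ([SemiAnbd] pp. 22–23, in descent-datum form, see the module docstring):
objects `S_v ∈ 𝒢_v`, `T_e ∈ 𝒢_e` and gluing isomorphisms `ψ_b : b^* S_v ⥲ T_e` for every branch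
`b ∈ e` abutting to `v`. [cite: MochizukiSemiAnbd2006, Def. 2.1 pp.22-23] -/
structure BObj where
  /-- the vertex objects `S_v` -/
  S : ∀ v : 𝒢.graph.Vertex, 𝒢.V v
  /-- the edge objects `T_e` -/
  T : ∀ e : 𝒢.graph.Edge, 𝒢.E e
  /-- the gluing isomorphisms `ψ_b : b^* S_v ⥲ T_e` -/
  ψ : ∀ (b : 𝒢.graph.Branch) (v : 𝒢.graph.Vertex) (h : 𝒢.graph.abuts b = some v),
    (𝒢.pull b v h).pullback.obj (S v) ≅ T (𝒢.graph.edgeOf b)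

variable {𝒢}

/-- A morphism of `B(𝒢)`: "morphisms [in the evident sense] between such data" (p. 23) — families
of morphisms of vertex objects and of edge objects compatible with the gluing isomorphisms.
[cite: MochizukiSemiAnbd2006, Def. 2.1 p.23] -/
@[ext] structure BObj.Hom (A B : 𝒢.BObj) where
  /-- the vertex components -/
  fS : ∀ v : 𝒢.graph.Vertex, A.S v ⟶ B.S v
  /-- the edge components -/
  fT : ∀ e : 𝒢.graph.Edge, A.T e ⟶ B.T e
  /-- compatibility with the gluing isomorphisms -/
  comm : ∀ (b : 𝒢.graph.Branch) (v : 𝒢.graph.Vertex) (h : 𝒢.graph.abuts b = some v),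
    (𝒢.pull b v h).pullback.map (fS v) ≫ (B.ψ b v h).hom = (A.ψ b v h).hom ≫ fT (𝒢.graph.edgeOf b)

/-- `B(𝒢)` is a category. [cite: MochizukiSemiAnbd2006, Def. 2.1 p.23] -/
instance : Category 𝒢.BObj where
  Hom := BObj.Hom
  id A := { fS := fun v => 𝟙 (A.S v), fT := fun e => 𝟙 (A.T e), comm := by simp }
  comp f g :=
    { fS := fun v => f.fS v ≫ g.fS v
      fT := fun e => f.fT e ≫ g.fT e
      comm := fun b v h => by
        rw [Functor.map_comp, Category.assoc, g.comm b v h, ← Category.assoc, f.comm b v h,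
          Category.assoc] }
  id_comp f := by ext <;> simp
  comp_id f := by ext <;> simp
  assoc f g h := by ext <;> simp

/-- Two morphisms of `B(𝒢)` agree if their vertex and edge components agree.
[cite: MochizukiSemiAnbd2006, Def. 2.1 p.23] -/
@[ext] theorem BObj.hom_ext {A B : 𝒢.BObj} (f g : A ⟶ B) (hS : f.fS = g.fS) (hT : f.fT = g.fT) :
    f = g :=
  BObj.Hom.ext hS hT

/-- Vertex components of identities. [cite: MochizukiSemiAnbd2006, Def. 2.1 p.23] -/
@[simp] theorem BObj.id_fS (A : 𝒢.BObj) (v : 𝒢.graph.Vertex) : (𝟙 A : A ⟶ A).fS v = 𝟙 (A.S v) := rfl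
/-- Edge components of identities. [cite: MochizukiSemiAnbd2006, Def. 2.1 p.23] -/
@[simp] theorem BObj.id_fT (A : 𝒢.BObj) (e : 𝒢.graph.Edge) : (𝟙 A : A ⟶ A).fT e = 𝟙 (A.T e) := rfl
/-- Vertex components of composites. [cite: MochizukiSemiAnbd2006, Def. 2.1 p.23] -/
@[simp] theorem BObj.comp_fS {A B C : 𝒢.BObj} (f : A ⟶ B) (g : B ⟶ C) (v : 𝒢.graph.Vertex) :
    (f ≫ g).fS v = f.fS v ≫ g.fS v := rfl
/-- Edge components of composites. [cite: MochizukiSemiAnbd2006, Def. 2.1 p.23] -/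
@[simp] theorem BObj.comp_fT {A B C : 𝒢.BObj} (f : A ⟶ B) (g : B ⟶ C) (e : 𝒢.graph.Edge) :
    (f ≫ g).fT e = f.fT e ≫ g.fT e := rfl

variable (𝒢)

/-! ### Fundamental groups (pp. 23–24) -/

/-- The restriction functor `ρ_v : B(𝒢) ⥤ 𝒢_v`, `{S_v, φ_e} ↦ S_v`: the pull-back functor of the
morphism of anabelioids `𝒢_v → B(𝒢)` inducing `Π_v → Π_𝒢` (p. 23).
[cite: MochizukiSemiAnbd2006, Def. 2.1 p.23] -/
def ρ (v : 𝒢.graph.Vertex) : 𝒢.BObj ⥤ 𝒢.V v where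
  obj A := A.S v
  map f := f.fS v

/-- The restriction functor `ρ_e : B(𝒢) ⥤ 𝒢_e`, `{S_v, φ_e} ↦ T_e` (the object over the edge `e`),
the pull-back functor of `𝒢_e → B(𝒢)` (p. 23). [cite: MochizukiSemiAnbd2006, Def. 2.1 p.23] -/
def ρE (e : 𝒢.graph.Edge) : 𝒢.BObj ⥤ 𝒢.E e where
  obj A := A.T e
  map f := f.fT e

/-- NAMED FACT ([SemiAnbd] p. 23): "One verifies immediately that this category `B(𝒢)` is a
connected anabelioid" (for connected `𝒢`), together with the assertion implicit in "`Π_𝒢 := π̂₁(B(𝒢))`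
… natural outer homomorphisms `Π_v → Π_𝒢`" that the restriction `ρ_v : B(𝒢) ⥤ 𝒢_v` composed with a
basepoint of `𝒢_v` is a basepoint of `B(𝒢)`. [cite: MochizukiSemiAnbd2006, Def. 2.1 p.23] -/
def bOf_galoisCategory : Prop :=
  ∀ (𝒢 : SemiGraphOfAnabelioids.{v₁, u₁, u}), 𝒢.IsConnected →
    ∃ _ : GaloisCategory 𝒢.BObj, ∀ (v : 𝒢.graph.Vertex) (F : 𝒢.V v ⥤ FintypeCat.{v₁})
      [FiberFunctor F], Nonempty (FiberFunctor (𝒢.ρ v ⋙ F))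

/-- `Π_𝒢 := π̂₁(B(𝒢))` relative to the basepoint through the vertex `v` given by a basepoint `β`
(functor `F`) of `𝒢_v`: the automorphism group of `ρ_v ⋙ F` (p. 23, "for some choice of
basepoint"). [cite: MochizukiSemiAnbd2006, Def. 2.1 p.23] -/
abbrev Pi (v : 𝒢.graph.Vertex) (F : 𝒢.V v ⥤ FintypeCat.{w}) : Type _ := Aut (𝒢.ρ v ⋙ F)

/-- `Π_v`: the fundamental group of the constituent anabelioid `𝒢_v` for the basepoint `F`
(p. 23). [cite: MochizukiSemiAnbd2006, Def. 2.1 p.23] -/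
abbrev PiV (v : 𝒢.graph.Vertex) (F : 𝒢.V v ⥤ FintypeCat.{w}) : Type _ := Aut F

/-- `Π_b`: the fundamental group of the edge anabelioid `𝒢_e`, `e ∋ b`, for the basepoint `F`
(p. 23; the subscript `b` signals that it is to be mapped into `Π_v` along `b`).
[cite: MochizukiSemiAnbd2006, Def. 2.1 p.23] -/
abbrev PiB (b : 𝒢.graph.Branch) (F : 𝒢.E (𝒢.graph.edgeOf b) ⥤ FintypeCat.{w}) : Type _ := Aut F

/-- The natural homomorphism `Π_v → Π_𝒢` (p. 23), for the basepoint of `B(𝒢)` through `v`.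
[cite: MochizukiSemiAnbd2006, Def. 2.1 p.23] -/
abbrev piVToPi (v : 𝒢.graph.Vertex) (F : 𝒢.V v ⥤ FintypeCat.{w}) : 𝒢.PiV v F →* 𝒢.Pi v F :=
  pi1Map (𝒢.ρ v) F

/-- The homomorphism `Π_b → Π_v` determined by the branch `b` abutting to `v` (p. 23), for the
basepoint `F` of `𝒢_e` and the induced basepoint `b^* ⋙ F` of `𝒢_v`.
[cite: MochizukiSemiAnbd2006, Def. 2.1 p.23] -/
abbrev piBToPiV (b : 𝒢.graph.Branch) (v : 𝒢.graph.Vertex) (h : 𝒢.graph.abuts b = some v)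
    (F : 𝒢.E (𝒢.graph.edgeOf b) ⥤ FintypeCat.{w}) :
    𝒢.PiB b F →* 𝒢.PiV v ((𝒢.pull b v h).pullback ⋙ F) :=
  pi1Map (𝒢.pull b v h).pullback F

/-- The natural homomorphism `Π_b → Π_𝒢` (p. 23): `Π_b → Π_v → Π_𝒢` for the induced basepoints.
[cite: MochizukiSemiAnbd2006, Def. 2.1 p.23] -/
noncomputable abbrev piBToPi (b : 𝒢.graph.Branch) (v : 𝒢.graph.Vertex)
    (h : 𝒢.graph.abuts b = some v) (F : 𝒢.E (𝒢.graph.edgeOf b) ⥤ FintypeCat.{w}) :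
    𝒢.PiB b F →* 𝒢.Pi v ((𝒢.pull b v h).pullback ⋙ F) :=
  (𝒢.piVToPi v ((𝒢.pull b v h).pullback ⋙ F)).comp (𝒢.piBToPiV b v h F)

/-- For `𝒢` of injective type, "the image of `Π_b` in `Π_v`, which is well-defined up to
conjugation in `Π_v`", again denoted `Π_b` (pp. 23–24): here as an honest subgroup of `Π_v` for the
basepoint `β` of `𝒢_v`, depending on a chosen isomorphism `α` from the basepoint induced from `𝒢_e`
to `β` (different choices give conjugate subgroups). [cite: MochizukiSemiAnbd2006, Def. 2.1 pp.23-24] -/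
noncomputable def branchSubgroup {v : 𝒢.graph.Vertex} (F : 𝒢.V v ⥤ FintypeCat.{w})
    (b : 𝒢.graph.Branch) (h : 𝒢.graph.abuts b = some v)
    (Fe : 𝒢.E (𝒢.graph.edgeOf b) ⥤ FintypeCat.{w}) (α : (𝒢.pull b v h).pullback ⋙ Fe ≅ F) :
    Subgroup (𝒢.PiV v F) :=
  ((Aut.autMulEquivOfIso α).toMonoidHom.comp (𝒢.piBToPiV b v h Fe)).range

/-! ### Restriction to a sub-semi-graph (p. 24) -/

/-- `𝒢_ℍ`: the semi-graph of anabelioids obtained by restricting `𝒢` to a sub-semi-graph `ℍ ⊆ 𝔾`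
(p. 24): underlying semi-graph `ℍ`, `(𝒢_ℍ)_c := 𝒢_c`, and the `b_*` of `𝒢`.
[cite: MochizukiSemiAnbd2006, Def. 2.1 p.24] -/
noncomputable def restrict (H : 𝒢.graph.Subgraph) : SemiGraphOfAnabelioids.{v₁, u₁, u} where
  graph := H.toSemiGraph
  V v := 𝒢.V v.1
  E e := 𝒢.E e.1
  pull b v h := 𝒢.pull b.1 v.1 (H.ι.abuts_branchMap b v h)

/-- The restriction functor `B(𝒢) ⥤ B(𝒢_ℍ)` (restrict the data to `ℍ`): the pull-back functor of
the morphism of anabelioids `B(𝒢_ℍ) → B(𝒢)` inducing `Π_ℍ → Π_𝒢` (p. 24).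
[cite: MochizukiSemiAnbd2006, Def. 2.1 p.24] -/
noncomputable def restrictFunctor (H : 𝒢.graph.Subgraph) : 𝒢.BObj ⥤ (𝒢.restrict H).BObj where
  obj A := { S := fun v => A.S v.1, T := fun e => A.T e.1, ψ := fun b v h => A.ψ b.1 v.1 _ }
  map f := { fS := fun v => f.fS v.1, fT := fun e => f.fT e.1, comm := fun b v h => f.comm b.1 v.1 _ }

/-- `Π_ℍ` for a sub-semi-graph `ℍ` (p. 24), relative to the basepoint through a vertex `v` of `ℍ`:
the fundamental group of `B(𝒢_ℍ)`. [cite: MochizukiSemiAnbd2006, Def. 2.1 p.24] -/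
noncomputable abbrev PiH (H : 𝒢.graph.Subgraph) (v : H.toSemiGraph.Vertex) (F : 𝒢.V v.1 ⥤ FintypeCat.{w}) :
    Type _ :=
  (𝒢.restrict H).Pi v F

/-- The natural homomorphism `Π_ℍ → Π_𝒢` (p. 24), for the basepoints through a vertex `v` of `ℍ`
(note `restrictFunctor ⋙ ρ_v^{ℍ} = ρ_v`). [cite: MochizukiSemiAnbd2006, Def. 2.1 p.24] -/
noncomputable abbrev piHToPi (H : 𝒢.graph.Subgraph) (v : H.toSemiGraph.Vertex) (F : 𝒢.V v.1 ⥤ FintypeCat.{w}) :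
    𝒢.PiH H v F →* 𝒢.Pi v.1 F :=
  pi1Map (𝒢.restrictFunctor H) ((𝒢.restrict H).ρ v ⋙ F)

/-! ### Morphisms of semi-graphs of anabelioids (Def. 2.1 p. 22; Remark 2.4.2 p. 26) -/

variable {𝒢}

/-- A *(1-)morphism of semi-graphs of anabelioids* `φ : 𝒢 → ℋ` ("evident notion", Def. 2.1 p. 22,
made explicit in Remark 2.4.2 p. 26): a morphism of underlying semi-graphs; for each vertex
`v ↦ w` (resp. edge `e ↦ f`) a 1-morphism of anabelioids `φ_v : 𝒢_v → ℋ_w` (resp.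
`φ_e : 𝒢_e → ℋ_f`); and, whenever a branch `b` of `e` abuts to `v`, an isomorphism `φ_b` between the
composites `𝒢_e → 𝒢_v → ℋ_w` and `𝒢_e → ℋ_f → ℋ_w` (as pull-back functors `ℋ_w ⥤ 𝒢_e`).  The edge
components are indexed by `(e, f, proof of e ↦ f)` to avoid transport along `edgeOf (φ b) = φ e`.
[cite: MochizukiSemiAnbd2006, Rem. 2.4.2 p.26] -/
structure Hom (𝒢 ℋ : SemiGraphOfAnabelioids.{v₁, u₁, u}) where
  /-- the underlying morphism of semi-graphs -/
  base : 𝒢.graph ⟶ ℋ.graph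
  /-- the vertex components `φ_v : 𝒢_v → ℋ_{φ v}` -/
  φV : ∀ v : 𝒢.graph.Vertex, Anabelioids.Hom (𝒢.V v) (ℋ.V (base.vertexMap v))
  /-- the edge components `φ_e : 𝒢_e → ℋ_f` for `f` the image of `e` -/
  φE : ∀ (e : 𝒢.graph.Edge) (f : ℋ.graph.Edge), base.edgeMap e = f →
    Anabelioids.Hom (𝒢.E e) (ℋ.E f)
  /-- the 2-isomorphisms `φ_b` -/
  φB : ∀ (b : 𝒢.graph.Branch) (v : 𝒢.graph.Vertex) (h : 𝒢.graph.abuts b = some v),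
    (φV v).pullback ⋙ (𝒢.pull b v h).pullback ≅
      (ℋ.pull (base.branchMap b) (base.vertexMap v) (base.abuts_branchMap b v h)).pullback ⋙
        (φE (𝒢.graph.edgeOf b) (ℋ.graph.edgeOf (base.branchMap b))
          (base.edgeOf_branchMap b).symm).pullback

/-- A morphism is *locally trivial* if each of its induced morphisms between constituent
anabelioids is an isomorphism ([SemiAnbd] Def. 2.2 (ii), p. 24).
[cite: MochizukiSemiAnbd2006, Def. 2.2(ii) p.24] -/
def Hom.IsLocallyTrivial {𝒢 ℋ : SemiGraphOfAnabelioids.{v₁, u₁, u}} (φ : Hom 𝒢 ℋ) : Prop :=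
  (∀ v, (φ.φV v).IsIsomorphism) ∧ ∀ e, (φ.φE e (φ.base.edgeMap e) rfl).IsIsomorphism

/-- A morphism is *locally finite étale* if each of its induced morphisms between constituent
anabelioids is finite étale ([SemiAnbd] Def. 2.2 (ii), p. 24).
[cite: MochizukiSemiAnbd2006, Def. 2.2(ii) p.24] -/
def Hom.IsLocallyFiniteEtale {𝒢 ℋ : SemiGraphOfAnabelioids.{v₁, u₁, u}} (φ : Hom 𝒢 ℋ) : Prop :=
  (∀ v, IsFiniteEtale (φ.φV v).pullback) ∧ ∀ e, IsFiniteEtale (φ.φE e (φ.base.edgeMap e) rfl).pullback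

/-- A morphism is *locally open* if each of its induced morphisms between constituent anabelioids
induces a homomorphism with open image between the respective `π̂₁`'s ([SemiAnbd] Def. 2.2 (ii),
p. 24), for every basepoint. [cite: MochizukiSemiAnbd2006, Def. 2.2(ii) p.24] -/
def Hom.IsLocallyOpen {𝒢 ℋ : SemiGraphOfAnabelioids.{v₁, u₁, u}} (φ : Hom 𝒢 ℋ) : Prop :=
  (∀ (v : 𝒢.graph.Vertex) (F : 𝒢.V v ⥤ FintypeCat.{v₁}) [FiberFunctor F],
      IsOpen (Set.range (pi1Map (φ.φV v).pullback F))) ∧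
    ∀ (e : 𝒢.graph.Edge) (F : 𝒢.E e ⥤ FintypeCat.{v₁}) [FiberFunctor F],
      IsOpen (Set.range (pi1Map (φ.φE e (φ.base.edgeMap e) rfl).pullback F))

end SemiGraphOfAnabelioids

end Literature.AnabelianGeometry.SemiGraphs
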